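import Summits.ValiantsHypothesis.ValiantsHypothesis.Theorems.LacunarySymmetroidMatrixDescartesDoorA26WallBubblingDoublyConfluentCount

/-!
# Wall bubbling for `DoorA26` — TWO WEYL PAIRS: the member dictionary of the two-pair chain, part A (classes; pure and mixed classes)

HONEST FRAMING.  Bookkeeping for obligation (W) `stub_weylFaces` (crux `DoorA26`, stmt-ValiantsHypothesis-19979; OPEN, typed, never asserted), W1 seat
val-sym-door-p2 g13 (#52a), used by the two-pair chain assembly W1 #52 `…TwoPairChain`.  At a two-Weyl-pair point (pairs at `0,5` / `1,4`; coincidence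
pattern `hG` ⊇ value-generic ∪ wall (c1) `{A,B}~{2,3}` ∪ wall (c2) `{A,2}~{B,3}`) an ALIVE member `(p,q)` (abstract symmetric relation `A`) of a given
value and given confluent degree `[p ∈ {4,5}] + [q ∈ {4,5}]` is one of an explicit list of frame slots: `twoPair_classes`, `twoPair_member_classes`,
`twoPair_deg`, and the dictionaries for the pure classes `2δ₀`, `2δ₁` and the mixed class `δ₀+δ₁`.  Pure finite bookkeeping (generated case trees).
Def-free; nothing on `DoorA26`, 18050 or VP ≠ VNP.  `--supports stmt-ValiantsHypothesis-19979 --as helper`.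
-/

-- `Summit.ValiantsHypothesis.ValiantsHypothesis.…` repeats a component by the D-0017 layout
-- (single-conjunct summit), which the `dupNamespace` linter flags; the name is mandated.
set_option linter.dupNamespace false

namespace Summit.ValiantsHypothesis.ValiantsHypothesis.Theorems.LacunarySymmetroidMatrixDescartes.WallBubbling

open Finset
open scoped BigOperators

/-- The class of each of the six positions at a two-Weyl-pair point (`A = {0,5} ↦ 0`, `B = {1,4} ↦ 1`, `2 ↦ 2`, `3 ↦ 3`). [this work] -/
theorem twoPair_classes (δ0 : Fin 6 → ℝ) (h50 : δ0 5 = δ0 0) (h41 : δ0 4 = δ0 1) :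
    ∀ p : Fin 6, ∃ a : Fin 4, δ0 p = δ0 a.castSucc.castSucc ∧
      (a = 0 ↔ (p = 0 ∨ p = 5)) ∧ (a = 1 ↔ (p = 1 ∨ p = 4)) ∧ (a = 2 ↔ p = 2) ∧ (a = 3 ↔ p = 3) := by
  intro p
  fin_cases p
  · exact ⟨0, rfl, by decide, by decide, by decide, by decide⟩
  · exact ⟨1, rfl, by decide, by decide, by decide, by decide⟩
  · exact ⟨2, rfl, by decide, by decide, by decide, by decide⟩
  · exact ⟨3, rfl, by decide, by decide, by decide, by decide⟩
  · exact ⟨1, h41, by decide, by decide, by decide, by decide⟩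
  · exact ⟨0, h50, by decide, by decide, by decide, by decide⟩

/-- The coincidence pattern `hG` read on members: the classes of a member of a given value. [this work] -/
theorem twoPair_member_classes (δ0 : Fin 6 → ℝ) (h50 : δ0 5 = δ0 0) (h41 : δ0 4 = δ0 1)
    (hG : ∀ a b c e : Fin 4, δ0 a.castSucc.castSucc + δ0 b.castSucc.castSucc = δ0 c.castSucc.castSucc + δ0 e.castSucc.castSucc →
      (a = c ∧ b = e) ∨ (a = e ∧ b = c) ∨
        ((((a = 0 ∧ b = 1) ∨ (a = 1 ∧ b = 0)) ∧ ((c = 2 ∧ e = 3) ∨ (c = 3 ∧ e = 2))) ∨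
         (((a = 2 ∧ b = 3) ∨ (a = 3 ∧ b = 2)) ∧ ((c = 0 ∧ e = 1) ∨ (c = 1 ∧ e = 0)))) ∨
        ((((a = 0 ∧ b = 2) ∨ (a = 2 ∧ b = 0)) ∧ ((c = 1 ∧ e = 3) ∨ (c = 3 ∧ e = 1))) ∨
         (((a = 1 ∧ b = 3) ∨ (a = 3 ∧ b = 1)) ∧ ((c = 0 ∧ e = 2) ∨ (c = 2 ∧ e = 0))))) :
    ∀ p q : Fin 6, ∀ a₀ b₀ : Fin 4, δ0 p + δ0 q = δ0 a₀.castSucc.castSucc + δ0 b₀.castSucc.castSucc →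
      ∃ a b : Fin 4, ((a = 0 ↔ (p = 0 ∨ p = 5)) ∧ (a = 1 ↔ (p = 1 ∨ p = 4)) ∧ (a = 2 ↔ p = 2) ∧ (a = 3 ↔ p = 3)) ∧
        ((b = 0 ↔ (q = 0 ∨ q = 5)) ∧ (b = 1 ↔ (q = 1 ∨ q = 4)) ∧ (b = 2 ↔ q = 2) ∧ (b = 3 ↔ q = 3)) ∧
        ((a = a₀ ∧ b = b₀) ∨ (a = b₀ ∧ b = a₀) ∨
        ((((a = 0 ∧ b = 1) ∨ (a = 1 ∧ b = 0)) ∧ ((a₀ = 2 ∧ b₀ = 3) ∨ (a₀ = 3 ∧ b₀ = 2))) ∨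
         (((a = 2 ∧ b = 3) ∨ (a = 3 ∧ b = 2)) ∧ ((a₀ = 0 ∧ b₀ = 1) ∨ (a₀ = 1 ∧ b₀ = 0)))) ∨
        ((((a = 0 ∧ b = 2) ∨ (a = 2 ∧ b = 0)) ∧ ((a₀ = 1 ∧ b₀ = 3) ∨ (a₀ = 3 ∧ b₀ = 1))) ∨
         (((a = 1 ∧ b = 3) ∨ (a = 3 ∧ b = 1)) ∧ ((a₀ = 0 ∧ b₀ = 2) ∨ (a₀ = 2 ∧ b₀ = 0))))) := by
  intro p q a₀ b₀ h
  obtain ⟨a, ha, hca⟩ := twoPair_classes δ0 h50 h41 p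
  obtain ⟨b, hb, hcb⟩ := twoPair_classes δ0 h50 h41 q
  exact ⟨a, b, hca, hcb, hG a b a₀ b₀ (by rw [← ha, ← hb]; exact h)⟩

/-- The confluent degree of a position: `1` at `4, 5`. [this work] -/
theorem twoPair_deg (p : Fin 6) : (if p = 5 then 1 else if p = 4 then 1 else 0) = (if (p = 4 ∨ p = 5) then 1 else 0) := by
  fin_cases p <;> simp

/-- Pure class `2δ₀`: a degree-2 member alive ⇒ the `t²`-slot `(5,5)` is alive. [this work] -/
theorem twoPair_dict_T0_2 (δ0 : Fin 6 → ℝ) (h50 : δ0 5 = δ0 0) (h41 : δ0 4 = δ0 1)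
    (hG : ∀ a b c e : Fin 4, δ0 a.castSucc.castSucc + δ0 b.castSucc.castSucc = δ0 c.castSucc.castSucc + δ0 e.castSucc.castSucc →
      (a = c ∧ b = e) ∨ (a = e ∧ b = c) ∨
        ((((a = 0 ∧ b = 1) ∨ (a = 1 ∧ b = 0)) ∧ ((c = 2 ∧ e = 3) ∨ (c = 3 ∧ e = 2))) ∨
         (((a = 2 ∧ b = 3) ∨ (a = 3 ∧ b = 2)) ∧ ((c = 0 ∧ e = 1) ∨ (c = 1 ∧ e = 0)))) ∨
        ((((a = 0 ∧ b = 2) ∨ (a = 2 ∧ b = 0)) ∧ ((c = 1 ∧ e = 3) ∨ (c = 3 ∧ e = 1))) ∨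
         (((a = 1 ∧ b = 3) ∨ (a = 3 ∧ b = 1)) ∧ ((c = 0 ∧ e = 2) ∨ (c = 2 ∧ e = 0)))))
    (A : Fin 6 → Fin 6 → Prop) (_hAs : ∀ p q, A p q → A q p) :
    ∀ p q : Fin 6, δ0 p + δ0 q = δ0 0 + δ0 0 → A p q →
      (if p = 5 then 1 else if p = 4 then 1 else 0) + (if q = 5 then 1 else if q = 4 then 1 else 0) = 2 → A 5 5 := by
  intro p q hpq hpol hdg
  obtain ⟨a, b, hca, hcb, hdisj⟩ := twoPair_member_classes δ0 h50 h41 hG p q 0 0 hpq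
  rw [twoPair_deg, twoPair_deg] at hdg
  rcases hdisj with ⟨ha, hb⟩ | ⟨ha, hb⟩ | ⟨⟨hab, hl⟩ | ⟨hab, hl⟩⟩ | ⟨⟨hab, hl⟩ | ⟨hab, hl⟩⟩
  · rcases hca.1.mp ha with rfl | rfl
    · rcases hcb.1.mp hb with rfl | rfl
      · simp at hdg
      · simp at hdg
    · rcases hcb.1.mp hb with rfl | rfl
      · simp at hdg
      · exact hpol
  · rcases hca.1.mp ha with rfl | rfl
    · rcases hcb.1.mp hb with rfl | rfl
      · simp at hdg
      · simp at hdg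
    · rcases hcb.1.mp hb with rfl | rfl
      · simp at hdg
      · exact hpol
  · exact absurd hl (by decide)
  · exact absurd hl (by decide)
  · exact absurd hl (by decide)
  · exact absurd hl (by decide)

/-- Pure class `2δ₀`: a degree-1 member alive ⇒ the `t`-slot `(0,5)` is alive. [this work] -/
theorem twoPair_dict_T0_1 (δ0 : Fin 6 → ℝ) (h50 : δ0 5 = δ0 0) (h41 : δ0 4 = δ0 1)
    (hG : ∀ a b c e : Fin 4, δ0 a.castSucc.castSucc + δ0 b.castSucc.castSucc = δ0 c.castSucc.castSucc + δ0 e.castSucc.castSucc →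
      (a = c ∧ b = e) ∨ (a = e ∧ b = c) ∨
        ((((a = 0 ∧ b = 1) ∨ (a = 1 ∧ b = 0)) ∧ ((c = 2 ∧ e = 3) ∨ (c = 3 ∧ e = 2))) ∨
         (((a = 2 ∧ b = 3) ∨ (a = 3 ∧ b = 2)) ∧ ((c = 0 ∧ e = 1) ∨ (c = 1 ∧ e = 0)))) ∨
        ((((a = 0 ∧ b = 2) ∨ (a = 2 ∧ b = 0)) ∧ ((c = 1 ∧ e = 3) ∨ (c = 3 ∧ e = 1))) ∨
         (((a = 1 ∧ b = 3) ∨ (a = 3 ∧ b = 1)) ∧ ((c = 0 ∧ e = 2) ∨ (c = 2 ∧ e = 0)))))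
    (A : Fin 6 → Fin 6 → Prop) (hAs : ∀ p q, A p q → A q p) :
    ∀ p q : Fin 6, δ0 p + δ0 q = δ0 0 + δ0 0 → A p q →
      (if p = 5 then 1 else if p = 4 then 1 else 0) + (if q = 5 then 1 else if q = 4 then 1 else 0) = 1 → A 0 5 := by
  intro p q hpq hpol hdg
  obtain ⟨a, b, hca, hcb, hdisj⟩ := twoPair_member_classes δ0 h50 h41 hG p q 0 0 hpq
  rw [twoPair_deg, twoPair_deg] at hdg
  rcases hdisj with ⟨ha, hb⟩ | ⟨ha, hb⟩ | ⟨⟨hab, hl⟩ | ⟨hab, hl⟩⟩ | ⟨⟨hab, hl⟩ | ⟨hab, hl⟩⟩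
  · rcases hca.1.mp ha with rfl | rfl
    · rcases hcb.1.mp hb with rfl | rfl
      · simp at hdg
      · exact hpol
    · rcases hcb.1.mp hb with rfl | rfl
      · exact (hAs 5 0 hpol)
      · simp at hdg
  · rcases hca.1.mp ha with rfl | rfl
    · rcases hcb.1.mp hb with rfl | rfl
      · simp at hdg
      · exact hpol
    · rcases hcb.1.mp hb with rfl | rfl
      · exact (hAs 5 0 hpol)
      · simp at hdg
  · exact absurd hl (by decide)
  · exact absurd hl (by decide)
  · exact absurd hl (by decide)
  · exact absurd hl (by decide)

/-- Pure class `2δ₁`: degree 2 ⇒ `(4,4)`. [this work] -/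
theorem twoPair_dict_T1_2 (δ0 : Fin 6 → ℝ) (h50 : δ0 5 = δ0 0) (h41 : δ0 4 = δ0 1)
    (hG : ∀ a b c e : Fin 4, δ0 a.castSucc.castSucc + δ0 b.castSucc.castSucc = δ0 c.castSucc.castSucc + δ0 e.castSucc.castSucc →
      (a = c ∧ b = e) ∨ (a = e ∧ b = c) ∨
        ((((a = 0 ∧ b = 1) ∨ (a = 1 ∧ b = 0)) ∧ ((c = 2 ∧ e = 3) ∨ (c = 3 ∧ e = 2))) ∨
         (((a = 2 ∧ b = 3) ∨ (a = 3 ∧ b = 2)) ∧ ((c = 0 ∧ e = 1) ∨ (c = 1 ∧ e = 0)))) ∨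
        ((((a = 0 ∧ b = 2) ∨ (a = 2 ∧ b = 0)) ∧ ((c = 1 ∧ e = 3) ∨ (c = 3 ∧ e = 1))) ∨
         (((a = 1 ∧ b = 3) ∨ (a = 3 ∧ b = 1)) ∧ ((c = 0 ∧ e = 2) ∨ (c = 2 ∧ e = 0)))))
    (A : Fin 6 → Fin 6 → Prop) (_hAs : ∀ p q, A p q → A q p) :
    ∀ p q : Fin 6, δ0 p + δ0 q = δ0 1 + δ0 1 → A p q →
      (if p = 5 then 1 else if p = 4 then 1 else 0) + (if q = 5 then 1 else if q = 4 then 1 else 0) = 2 → A 4 4 := by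
  intro p q hpq hpol hdg
  obtain ⟨a, b, hca, hcb, hdisj⟩ := twoPair_member_classes δ0 h50 h41 hG p q 1 1 hpq
  rw [twoPair_deg, twoPair_deg] at hdg
  rcases hdisj with ⟨ha, hb⟩ | ⟨ha, hb⟩ | ⟨⟨hab, hl⟩ | ⟨hab, hl⟩⟩ | ⟨⟨hab, hl⟩ | ⟨hab, hl⟩⟩
  · rcases hca.2.1.mp ha with rfl | rfl
    · rcases hcb.2.1.mp hb with rfl | rfl
      · simp at hdg
      · simp at hdg
    · rcases hcb.2.1.mp hb with rfl | rfl
      · simp at hdg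
      · exact hpol
  · rcases hca.2.1.mp ha with rfl | rfl
    · rcases hcb.2.1.mp hb with rfl | rfl
      · simp at hdg
      · simp at hdg
    · rcases hcb.2.1.mp hb with rfl | rfl
      · simp at hdg
      · exact hpol
  · exact absurd hl (by decide)
  · exact absurd hl (by decide)
  · exact absurd hl (by decide)
  · exact absurd hl (by decide)

/-- Pure class `2δ₁`: degree 1 ⇒ `(1,4)`. [this work] -/
theorem twoPair_dict_T1_1 (δ0 : Fin 6 → ℝ) (h50 : δ0 5 = δ0 0) (h41 : δ0 4 = δ0 1)
    (hG : ∀ a b c e : Fin 4, δ0 a.castSucc.castSucc + δ0 b.castSucc.castSucc = δ0 c.castSucc.castSucc + δ0 e.castSucc.castSucc →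
      (a = c ∧ b = e) ∨ (a = e ∧ b = c) ∨
        ((((a = 0 ∧ b = 1) ∨ (a = 1 ∧ b = 0)) ∧ ((c = 2 ∧ e = 3) ∨ (c = 3 ∧ e = 2))) ∨
         (((a = 2 ∧ b = 3) ∨ (a = 3 ∧ b = 2)) ∧ ((c = 0 ∧ e = 1) ∨ (c = 1 ∧ e = 0)))) ∨
        ((((a = 0 ∧ b = 2) ∨ (a = 2 ∧ b = 0)) ∧ ((c = 1 ∧ e = 3) ∨ (c = 3 ∧ e = 1))) ∨
         (((a = 1 ∧ b = 3) ∨ (a = 3 ∧ b = 1)) ∧ ((c = 0 ∧ e = 2) ∨ (c = 2 ∧ e = 0)))))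
    (A : Fin 6 → Fin 6 → Prop) (hAs : ∀ p q, A p q → A q p) :
    ∀ p q : Fin 6, δ0 p + δ0 q = δ0 1 + δ0 1 → A p q →
      (if p = 5 then 1 else if p = 4 then 1 else 0) + (if q = 5 then 1 else if q = 4 then 1 else 0) = 1 → A 1 4 := by
  intro p q hpq hpol hdg
  obtain ⟨a, b, hca, hcb, hdisj⟩ := twoPair_member_classes δ0 h50 h41 hG p q 1 1 hpq
  rw [twoPair_deg, twoPair_deg] at hdg
  rcases hdisj with ⟨ha, hb⟩ | ⟨ha, hb⟩ | ⟨⟨hab, hl⟩ | ⟨hab, hl⟩⟩ | ⟨⟨hab, hl⟩ | ⟨hab, hl⟩⟩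
  · rcases hca.2.1.mp ha with rfl | rfl
    · rcases hcb.2.1.mp hb with rfl | rfl
      · simp at hdg
      · exact hpol
    · rcases hcb.2.1.mp hb with rfl | rfl
      · exact (hAs 4 1 hpol)
      · simp at hdg
  · rcases hca.2.1.mp ha with rfl | rfl
    · rcases hcb.2.1.mp hb with rfl | rfl
      · simp at hdg
      · exact hpol
    · rcases hcb.2.1.mp hb with rfl | rfl
      · exact (hAs 4 1 hpol)
      · simp at hdg
  · exact absurd hl (by decide)
  · exact absurd hl (by decide)
  · exact absurd hl (by decide)
  · exact absurd hl (by decide)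

/-- Mixed class `δ₀+δ₁` (with the (c1) partner `(2,3)` of degree 0): degree 2 ⇒ `(5,4)`. [this work] -/
theorem twoPair_dict_M_2 (δ0 : Fin 6 → ℝ) (h50 : δ0 5 = δ0 0) (h41 : δ0 4 = δ0 1)
    (hG : ∀ a b c e : Fin 4, δ0 a.castSucc.castSucc + δ0 b.castSucc.castSucc = δ0 c.castSucc.castSucc + δ0 e.castSucc.castSucc →
      (a = c ∧ b = e) ∨ (a = e ∧ b = c) ∨
        ((((a = 0 ∧ b = 1) ∨ (a = 1 ∧ b = 0)) ∧ ((c = 2 ∧ e = 3) ∨ (c = 3 ∧ e = 2))) ∨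
         (((a = 2 ∧ b = 3) ∨ (a = 3 ∧ b = 2)) ∧ ((c = 0 ∧ e = 1) ∨ (c = 1 ∧ e = 0)))) ∨
        ((((a = 0 ∧ b = 2) ∨ (a = 2 ∧ b = 0)) ∧ ((c = 1 ∧ e = 3) ∨ (c = 3 ∧ e = 1))) ∨
         (((a = 1 ∧ b = 3) ∨ (a = 3 ∧ b = 1)) ∧ ((c = 0 ∧ e = 2) ∨ (c = 2 ∧ e = 0)))))
    (A : Fin 6 → Fin 6 → Prop) (hAs : ∀ p q, A p q → A q p) :
    ∀ p q : Fin 6, δ0 p + δ0 q = δ0 0 + δ0 1 → A p q →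
      (if p = 5 then 1 else if p = 4 then 1 else 0) + (if q = 5 then 1 else if q = 4 then 1 else 0) = 2 → A 5 4 := by
  intro p q hpq hpol hdg
  obtain ⟨a, b, hca, hcb, hdisj⟩ := twoPair_member_classes δ0 h50 h41 hG p q 0 1 hpq
  rw [twoPair_deg, twoPair_deg] at hdg
  rcases hdisj with ⟨ha, hb⟩ | ⟨ha, hb⟩ | ⟨⟨hab, hl⟩ | ⟨hab, hl⟩⟩ | ⟨⟨hab, hl⟩ | ⟨hab, hl⟩⟩
  · rcases hca.1.mp ha with rfl | rfl
    · rcases hcb.2.1.mp hb with rfl | rfl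
      · simp at hdg
      · simp at hdg
    · rcases hcb.2.1.mp hb with rfl | rfl
      · simp at hdg
      · exact hpol
  · rcases hca.2.1.mp ha with rfl | rfl
    · rcases hcb.1.mp hb with rfl | rfl
      · simp at hdg
      · simp at hdg
    · rcases hcb.1.mp hb with rfl | rfl
      · simp at hdg
      · exact (hAs 4 5 hpol)
  · exact absurd hl (by decide)
  · rcases hab with ⟨ha, hb⟩ | ⟨ha, hb⟩
    · obtain rfl := hca.2.2.1.mp ha
      obtain rfl := hcb.2.2.2.mp hb
      simp at hdg
    · obtain rfl := hca.2.2.2.mp ha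
      obtain rfl := hcb.2.2.1.mp hb
      simp at hdg
  · exact absurd hl (by decide)
  · exact absurd hl (by decide)

/-- Mixed class `δ₀+δ₁`: degree 1 ⇒ `(0,4)` or `(5,1)`. [this work] -/
theorem twoPair_dict_M_1 (δ0 : Fin 6 → ℝ) (h50 : δ0 5 = δ0 0) (h41 : δ0 4 = δ0 1)
    (hG : ∀ a b c e : Fin 4, δ0 a.castSucc.castSucc + δ0 b.castSucc.castSucc = δ0 c.castSucc.castSucc + δ0 e.castSucc.castSucc →
      (a = c ∧ b = e) ∨ (a = e ∧ b = c) ∨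
        ((((a = 0 ∧ b = 1) ∨ (a = 1 ∧ b = 0)) ∧ ((c = 2 ∧ e = 3) ∨ (c = 3 ∧ e = 2))) ∨
         (((a = 2 ∧ b = 3) ∨ (a = 3 ∧ b = 2)) ∧ ((c = 0 ∧ e = 1) ∨ (c = 1 ∧ e = 0)))) ∨
        ((((a = 0 ∧ b = 2) ∨ (a = 2 ∧ b = 0)) ∧ ((c = 1 ∧ e = 3) ∨ (c = 3 ∧ e = 1))) ∨
         (((a = 1 ∧ b = 3) ∨ (a = 3 ∧ b = 1)) ∧ ((c = 0 ∧ e = 2) ∨ (c = 2 ∧ e = 0)))))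
    (A : Fin 6 → Fin 6 → Prop) (hAs : ∀ p q, A p q → A q p) :
    ∀ p q : Fin 6, δ0 p + δ0 q = δ0 0 + δ0 1 → A p q →
      (if p = 5 then 1 else if p = 4 then 1 else 0) + (if q = 5 then 1 else if q = 4 then 1 else 0) = 1 → A 0 4 ∨ A 5 1 := by
  intro p q hpq hpol hdg
  obtain ⟨a, b, hca, hcb, hdisj⟩ := twoPair_member_classes δ0 h50 h41 hG p q 0 1 hpq
  rw [twoPair_deg, twoPair_deg] at hdg
  rcases hdisj with ⟨ha, hb⟩ | ⟨ha, hb⟩ | ⟨⟨hab, hl⟩ | ⟨hab, hl⟩⟩ | ⟨⟨hab, hl⟩ | ⟨hab, hl⟩⟩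
  · rcases hca.1.mp ha with rfl | rfl
    · rcases hcb.2.1.mp hb with rfl | rfl
      · simp at hdg
      · exact Or.inl hpol
    · rcases hcb.2.1.mp hb with rfl | rfl
      · exact Or.inr hpol
      · simp at hdg
  · rcases hca.2.1.mp ha with rfl | rfl
    · rcases hcb.1.mp hb with rfl | rfl
      · simp at hdg
      · exact Or.inr (hAs 1 5 hpol)
    · rcases hcb.1.mp hb with rfl | rfl
      · exact Or.inl (hAs 4 0 hpol)
      · simp at hdg
  · exact absurd hl (by decide)
  · rcases hab with ⟨ha, hb⟩ | ⟨ha, hb⟩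
    · obtain rfl := hca.2.2.1.mp ha
      obtain rfl := hcb.2.2.2.mp hb
      simp at hdg
    · obtain rfl := hca.2.2.2.mp ha
      obtain rfl := hcb.2.2.1.mp hb
      simp at hdg
  · exact absurd hl (by decide)
  · exact absurd hl (by decide)

end Summit.ValiantsHypothesis.ValiantsHypothesis.Theorems.LacunarySymmetroidMatrixDescartes.WallBubbling
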